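import Summits.AtomisticToContinuum.Crystallization.Theorems.FrustratedLawDichotomyCellArithTaylor
import Summits.AtomisticToContinuum.Crystallization.Theorems.FrustratedLawDichotomyCellArithTails
import Summits.AtomisticToContinuum.Crystallization.Theorems.FrustratedLawDichotomyCellClasses

/-!
# FrustratedLawDichotomy · crux `AperiodicFrustratedLawGap` (stmt-AtomisticToContinuum-27623) — CELL-ARITH ⟶ (261) CELL CLASSES:
# the adapters BY NAME (decomp-a2c hand-1 g53; the interface of record, critic r1772 (B) / lens-5 REPLY l.9349 (1): «S·snbW lo hi ≤ X»,
# «S·erbW rlo rhi η ≤ X», «S·psiAbsW lo hi ≤ X», the LOWER reading of `shellMin`, so the class lemmas of (261) `…CellClasses` take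
# INTEGER numbers and a K-file proof is `decide` + one `exact` per column)

* §1 the three booked window expressions of (261) read in `ℤ` by name: `le_snbW` (`S·snbW lo hi ≤ secondNegHiZ S lo hi`), `le_erbW`
  (`S·erbW rlo rhi η ≤ energyRemHiZ S rlo rhi η`), `le_psiAbsW` (`S·psiAbsW lo hi ≤ absPsiHiZ S lo hi`) — each is the `_expr` theorem of
  `…CellArithLJ`/`…CellArithTaylor` behind an `unfold`;
* §2 the booked NUMBERS as integers over `S`: `debNum_ge` (`τ²·snbW + erbW ≤ debHiZ/S`), `nn0Num_ge` (`psiAbsW·rhi ≤ scHi rhi (absPsiHiZ)/S`),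
  and (Tails) `shellMinLoZ_div_le` (`shellMinLoZ/S ≤ shellMin`);
* §3 ★ the three CLASS LEMMAS of (261) WITH INTEGER NUMBERS — `host_of_nearId_Z`, `deb_of_nearId_Z`, `nn0_of_nearId_Z`: the (251)
  `hhost`/`hdeb`/`hnn` hypotheses for a label of a near-identity cell from its rational class windows and the CELL-ARITH readings,
  with NO real-number side condition left (the remaining hypotheses `rlo² ≤ lo`, `hi ≤ rhi²`, `0 < lo`, … are rational, `decide`d).

No new definitions (DEF-FREE); imports `…CellArithTaylor`, `…CellArithTails`, (261) `…CellClasses`; 0 sorry.  Tags: [folklore].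
-/

namespace Summit.AtomisticToContinuum.Crystallization.Theorems.FrustratedLawDichotomyCellArithClasses

open scoped BigOperators
open Summit.AtomisticToContinuum.Crystallization.Theorems.FrustratedLawDichotomyCoherentFloorAlgebra (phiT psiT secondNeg energyRem)
open Summit.AtomisticToContinuum.Crystallization.Theorems.FrustratedLawDichotomyShellMinimum (shellMin)
open Summit.AtomisticToContinuum.Crystallization.Theorems.FrustratedLawDichotomyCellMetric (posL)
open Summit.AtomisticToContinuum.Crystallization.Theorems.FrustratedLawDichotomyCellClasses
  (snbW erbW psiAbsW host_of_nearId deb_of_nearId nn0_of_nearId)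
open Summit.AtomisticToContinuum.Crystallization.Theorems.FrustratedLawDichotomyCellArith
open Summit.AtomisticToContinuum.Crystallization.Theorems.FrustratedLawDichotomyCellArithLJ
open Summit.AtomisticToContinuum.Crystallization.Theorems.FrustratedLawDichotomyCellArithTaylor
open Summit.AtomisticToContinuum.Crystallization.Theorems.FrustratedLawDichotomyCellArithTails (shellMinLoZ shellMinLoZ_div_le)

/-! ## §1 The booked window expressions of (261), read in `ℤ` by name -/

section Named

variable {S : ℤ} {lo hi rlo rhi η : ℚ}

/-- ★ «S·snbW lo hi ≤ X» with `X = secondNegHiZ S lo hi`. [folklore] -/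
theorem le_snbW (hS : 0 < S) (h0 : 0 < lo) (hh : 0 < hi) :
    S * snbW (lo : ℝ) (hi : ℝ) ≤ ((secondNegHiZ S lo hi : ℤ) : ℝ) := by
  unfold snbW; exact le_secondNegHiZ_expr hS h0 hh

/-- ★ «S·erbW rlo rhi η ≤ X» with `X = energyRemHiZ S rlo rhi η` (`0 ≤ η < rlo ≤ rhi`). [folklore] -/
theorem le_erbW (hS : 0 < S) (hη : 0 ≤ η) (hlo : η < rlo) (hle : rlo ≤ rhi) :
    S * erbW (rlo : ℝ) (rhi : ℝ) (η : ℝ) ≤ ((energyRemHiZ S rlo rhi η : ℤ) : ℝ) := by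
  unfold erbW; exact le_energyRemHiZ_expr hS hη hlo hle

/-- ★ «S·psiAbsW lo hi ≤ X» with `X = absPsiHiZ S lo hi`. [folklore] -/
theorem le_psiAbsW (hS : 0 < S) (h0 : 0 < lo) (hh : 0 < hi) :
    S * psiAbsW (lo : ℝ) (hi : ℝ) ≤ ((absPsiHiZ S lo hi : ℤ) : ℝ) := by
  unfold psiAbsW; exact le_absPsiHiZ_expr hS h0 hh

/-! ## §2 The booked numbers as integers over `S` -/

/-- ★ the DEBIT number: `τ²·snbW lo hi + erbW rlo rhi τ ≤ debHiZ S lo hi rlo rhi τ / S`. [folklore] -/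
theorem debNum_ge {τ : ℚ} (hS : 0 < S) (h0 : 0 < lo) (hh : 0 < hi) (hτ : 0 ≤ τ) (hlo : τ < rlo) (hle : rlo ≤ rhi) :
    (τ : ℝ) ^ 2 * snbW (lo : ℝ) (hi : ℝ) + erbW (rlo : ℝ) (rhi : ℝ) (τ : ℝ) ≤ ((debHiZ S lo hi rlo rhi τ : ℤ) : ℝ) / S := by
  refine le_div_of_reading hS ?_
  have A := le_scHi (c := τ ^ 2) (by positivity) (le_snbW hS h0 hh)
  have B := le_erbW hS hτ hlo hle
  unfold debHiZ; push_cast at A B ⊢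
  rw [mul_add]; exact add_le_add A B

/-- ★ the MULTIPLIER-FREE NASH number: `psiAbsW lo hi · rhi ≤ scHi rhi (absPsiHiZ S lo hi) / S` (`0 ≤ rhi`). [folklore] -/
theorem nn0Num_ge (hS : 0 < S) (h0 : 0 < lo) (hh : 0 < hi) (hrhi : 0 ≤ rhi) :
    psiAbsW (lo : ℝ) (hi : ℝ) * (rhi : ℝ) ≤ ((scHi rhi (absPsiHiZ S lo hi) : ℤ) : ℝ) / S := by
  refine le_div_of_reading hS ?_
  have A := le_scHi (c := rhi) hrhi (le_psiAbsW hS h0 hh)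
  have e : (S : ℝ) * (psiAbsW (lo : ℝ) (hi : ℝ) * (rhi : ℝ)) = S * ((rhi : ℝ) * psiAbsW (lo : ℝ) (hi : ℝ)) := by ring
  rw [e]; exact A

end Named

/-! ## §3 The class lemmas of (261) with integer numbers -/

section Classes

variable {S : ℤ} {F : Matrix (Fin 3) (Fin 3) ℝ} {ε : ℝ} {lo hi rlo rhi : ℚ}

/-- ★ HOST CLASS with the integer number `shellMinLoZ S lo hi`: the (251) `hhost` hypothesis `host m ≤ φ(‖pos m‖²)` for every label of the class
(`host m := shellMinLoZ/S`). [folklore] -/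
theorem host_of_nearId_Z (hG : ∀ i j, |(F.transpose * F) i j - (if i = j then 1 else 0)| ≤ ε) (v : Fin 3 → ℝ) (hS : 0 < S)
    (h0 : 0 < lo) (hlo : (lo : ℝ) ≤ (1 - 3 * ε) * ∑ i, v i ^ 2) (hhi : (1 + 3 * ε) * ∑ i, v i ^ 2 ≤ (hi : ℝ)) :
    ((shellMinLoZ S lo hi : ℤ) : ℝ) / S ≤ phiT (‖posL F v‖ ^ 2) :=
  host_of_nearId hG v (by exact_mod_cast h0) hlo hhi (shellMinLoZ_div_le hS lo hi)

/-- ★ DEBIT CLASS with the integer number `debHiZ S lo hi rlo rhi τq`: the (251) `hdeb` hypothesis (`deb m := debHiZ/S`), the real `τ` of the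
door tied to its rational value by `hτq`. [folklore] -/
theorem deb_of_nearId_Z (hG : ∀ i j, |(F.transpose * F) i j - (if i = j then 1 else 0)| ≤ ε) (v : Fin 3 → ℝ) {τ : ℝ} {τq : ℚ}
    (hτq : (τq : ℝ) = τ) (hS : 0 < S) (h0 : 0 < lo) (hlo : (lo : ℝ) ≤ (1 - 3 * ε) * ∑ i, v i ^ 2)
    (hhi : (1 + 3 * ε) * ∑ i, v i ^ 2 ≤ (hi : ℝ)) (hrlo2 : rlo ^ 2 ≤ lo) (hrhi : 0 ≤ rhi) (hrhi2 : hi ≤ rhi ^ 2) (hτ : 0 ≤ τq)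
    (hτr : τq < rlo) :
    τ ^ 2 * secondNeg ‖posL F v‖ + energyRem ‖posL F v‖ τ ≤ ((debHiZ S lo hi rlo rhi τq : ℤ) : ℝ) / S := by
  have hlohi : lo ≤ hi := by
    have h := Summit.AtomisticToContinuum.Crystallization.Theorems.FrustratedLawDichotomyCellData.norm_sq_mem_nearId hG v
    have : (lo : ℝ) ≤ hi := hlo.trans (h.1.trans (h.2.trans hhi))
    exact_mod_cast this
  have hh : 0 < hi := lt_of_lt_of_le h0 hlohi
  have hle : rlo ≤ rhi := (abs_le_of_sq_le_sq' (hrlo2.trans (hlohi.trans hrhi2)) hrhi).2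
  subst hτq
  exact deb_of_nearId hG v (by exact_mod_cast h0) hlo hhi (by exact_mod_cast hrlo2) (by exact_mod_cast hrhi)
    (by exact_mod_cast hrhi2) (by exact_mod_cast hτ) (by exact_mod_cast hτr) (debNum_ge hS h0 hh hτ hτr hle)

/-- ★ MULTIPLIER-FREE NASH CLASS with the integer number `scHi rhi (absPsiHiZ S lo hi)`: the (251) `hnn` hypothesis for a NASH-near label
whose certificate coefficient vanishes (`nn m := scHi rhi (absPsiHiZ S lo hi)/S`). [folklore] -/
theorem nn0_of_nearId_Z (hG : ∀ i j, |(F.transpose * F) i j - (if i = j then 1 else 0)| ≤ ε) (v : Fin 3 → ℝ) (hS : 0 < S)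
    (h0 : 0 < lo) (hlo : (lo : ℝ) ≤ (1 - 3 * ε) * ∑ i, v i ^ 2) (hhi : (1 + 3 * ε) * ∑ i, v i ^ 2 ≤ (hi : ℝ)) (hrhi : 0 ≤ rhi)
    (hrhi2 : hi ≤ rhi ^ 2) {C : EuclideanSpace ℝ (Fin 3)} (hC : C = 0) :
    ‖psiT (‖posL F v‖ ^ 2) • posL F v - C‖ ≤ ((scHi rhi (absPsiHiZ S lo hi) : ℤ) : ℝ) / S := by
  have hh : 0 < hi := by
    have h := Summit.AtomisticToContinuum.Crystallization.Theorems.FrustratedLawDichotomyCellData.norm_sq_mem_nearId hG v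
    have h' : (lo : ℝ) ≤ hi := hlo.trans (h.1.trans (h.2.trans hhi))
    have h'' : lo ≤ hi := by exact_mod_cast h'
    exact lt_of_lt_of_le h0 h''
  exact nn0_of_nearId hG v (by exact_mod_cast h0) hlo hhi (by exact_mod_cast hrhi) (by exact_mod_cast hrhi2)
    (nn0Num_ge hS h0 hh hrhi) hC

end Classes

end Summit.AtomisticToContinuum.Crystallization.Theorems.FrustratedLawDichotomyCellArithClasses
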